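import Literature.NumberTheory.EllipticCurves.PeriodIndexGlobalIndex
import Literature.NumberTheory.EllipticCurves.PeriodIndexFrobeniusTorsion
import Literature.NumberTheory.EllipticCurves.PeriodIndexThm2Reduction
import HarnessLib

/-!
# The index `P²` of a difference of corestricted Kummer classes
# (Clark–Sharif 2010, Theorem 2, §3.6: from Kummer data at one prime)

Topic `NumberTheory/EllipticCurves`; theorems only. This file assembles the Brauer-free proof of
the step "`I(ξ_i - ξ_j) = P²`" of Clark–Sharif's Theorem 2 (`PeriodIndexTwistedOrbitSums`,
`PeriodIndexDecompositionIndex`, `PeriodIndexGlobalIndex`, `PeriodIndexFrobeniusTorsion`) in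
the exact shape of hypothesis (ii) of
`Literature.NumberTheory.EllipticCurves.ClarkSharif2010_thm2_of_kummerClasses`
(`PeriodIndexThm2Reduction`): for the level field `k = K_P` (`fixingGal k` open normal,
`ζ ∈ k`, `E[P]` trivial as a `Gal(K̄/k)`-module, a choice of basis `ρ : (ℤ/P)² → E[P]`) and two
pairs `(a₁, b₁), (a₂, b₂) ∈ kˣ × kˣ`, the index of
`η₁ - η₂`, `η_n = (E[P] ⊂ E)_* cores_{k/K} Φ(a_n, b_n)`, is `P²`, provided that at ONE prime
`𝔓` of `\bar ℤ_K` — above a good place `v ∤ P` whose decomposition group lies in `Gal(K̄/k)`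
("`ṽ` splits completely in `K_P`", (SC5′)) — the cocycles
`Θ_n = Σ_x (s x)·Φ(a_n, b_n) = res_{Gal(K̄/k)} cores Φ(a_n, b_n)` (Lemma 15, Cor. 17;
`resCocycle_coresCocycle`) satisfy: `Θ₁` vanishes on `D_𝔓` ((SC3′) for the far pair), and the
`ρ`-coordinates `(χ₁, χ₂)` of `Θ₂|_{D_𝔓}` have `χ₁` onto on the inertia group, `χ₂` zero on
inertia and `χ₂(φ)` a unit (Lemmas 18–19: `a₂ = π` a uniformiser, the rest units, order `P` at
`φ`), together with the Galois form of (SC2′) and a `D_𝔓`-fixed `P`-th root of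
`(P(P-1)/2) ρ(1,0)` (from `E[2P] ⊂ E(K_P)` when `P` is even).

Main results: `index_neg` (`I(-η) = I(η)`),
`index_resH1Hom_coresH1_kummerPhi_sub_eq_sq` (the theorem above, with `P = pⁿ`, the Frobenius
`φ = σ|_{K̄}` of a local arithmetic Frobenius `σ` and `𝔓 = 𝔓_{ι,𝔐}`, as required by the
nice-point supply `exists_inertia_fixed_frobenius_pow_sub_eq`).

## References

* P. L. Clark, S. Sharif, *Period, index and potential Ш*, Algebra & Number Theory 4 (2010)
  151–174, §§3.4–3.6 (`ClarkSharif2010`; arXiv:0811.3019 read).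
-/

noncomputable section

open scoped Classical Pointwise
open NumberField IsDedekindDomain Field
open Literature.NumberTheory.GaloisRepresentations IsDedekindDomain.HeightOneSpectrum

universe u

namespace Literature.NumberTheory.EllipticCurves

/-! ### `I(-η) = I(η)` -/

section Neg

variable {K : Type u} [Field K] (W : WeierstrassCurve K)

/-- A class and its negative die over the same fields. [folklore] -/
theorem splittingDegrees_neg (η : W.galH1) : splittingDegrees W (-η) = splittingDegrees W η := by
  ext d
  constructor
  · rintro ⟨M, _, _, _, hd, hη⟩
    exact ⟨M, inferInstance, inferInstance, inferInstance, hd, by simpa using neg_mem hη⟩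
  · rintro ⟨M, _, _, _, hd, hη⟩
    exact ⟨M, inferInstance, inferInstance, inferInstance, hd, neg_mem hη⟩

/-- **`I(-η) = I(η)`.** [folklore] -/
theorem index_neg (η : W.galH1) : index W (-η) = index W η := by
  rw [index, index, splittingDegrees_neg]

end Neg

/-! ### From Kummer data to the index -/

variable {K : Type u} [Field K] [NumberField K] (W : WeierstrassCurve K) [W.IsElliptic]
variable {k : IntermediateField K (AlgebraicClosure K)} {P : ℕ} [NeZero P] {ζ : AlgebraicClosure K}

/-- **Clark–Sharif 2010, Theorem 2, "`I(ξ_i - ξ_j) = P²`" (§3.6), from Kummer data at one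
prime.** See the module docstring. The local inputs are the cocycles
`Θ_n = Σ_{x ∈ Γ_K/𝔤_k} (s x) · Φ(a_n, b_n)` on `𝔤_k = Gal(K̄/k)` (`s` any system of
representatives), which on `𝔤_k` are the corestrictions (`resCocycle_coresCocycle`): `Θ₁` is
assumed to vanish on the decomposition group `D_𝔓 ≤ 𝔤_k` and `Θ₂|_{D_𝔓} = ρ(χ₁, χ₂)` with `χ₁`
onto on `I_𝔓`, `χ₂` zero on `I_𝔓` and `χ₂(φ)` a unit. Then
`index (η₁ - η₂) = P²` for `η_n = (E[P] ⊂ E)_* cores Φ(a_n, b_n)`.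
[cite: ClarkSharif2010, Theorem 2 (§3.6, with Lemmas 15, 18, 19 and Cor. 17)] -/
theorem index_resH1Hom_coresH1_kummerPhi_sub_eq_sq
    (hN : IsOpen (fixingGal k : Set (absoluteGaloisGroup K))) [(fixingGal k).Normal]
    [Fintype (absoluteGaloisGroup K ⧸ fixingGal k)]
    (hζ : IsPrimitiveRoot ζ P) (hζk : ζ ∈ k)
    (htriv : ∀ (g : fixingGal k) (m : ↥(WeierstrassCurve.geomTorsion W (P : ℤ))), g • m = m)
    (ρ : ZMod P × ZMod P →+ ↥(WeierstrassCurve.geomTorsion W (P : ℤ))) (hρ : Function.Injective ρ)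
    {s : absoluteGaloisGroup K ⧸ fixingGal k → absoluteGaloisGroup K}
    (hs : ∀ x, (s x : absoluteGaloisGroup K ⧸ fixingGal k) = x)
    -- the prime
    {p n : ℕ} [Fact p.Prime] (hP : P = p ^ n)
    {v : HeightOneSpectrum (𝓞 K)} (hp : (p : 𝓞 K) ∉ v.asIdeal) (hv : W.HasGoodReductionAt v)
    {𝔐 : Ideal (localAbsIntegers v)} (h𝔐 : 𝔐 ∈ v.localPrimesAbove)
    (ι : AlgebraicClosure K →ₐ[K] AlgebraicClosure (v.adicCompletion K))
    {σL : absoluteGaloisGroup (v.adicCompletion K)}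
    (hσL : IsArithFrobAt (v.adicCompletionIntegers K) σL 𝔐)
    (hDN : (v.primeBelow ι 𝔐).decompositionSubgroup (absoluteGaloisGroup K) ≤ fixingGal k)
    -- the two pairs and the local shape of their norm cocycles on `D_𝔓`
    (a₁ b₁ a₂ b₂ : (↥k)ˣ)
    (hfar : ∀ σ (hσ : σ ∈ (v.primeBelow ι 𝔐).decompositionSubgroup (absoluteGaloisGroup K)),
      (∑ x, conjCocycle (fixingGal k) (s x) (kummerPhiCocycle hζ hζk htriv ρ a₁ b₁)).1 ⟨σ, hDN hσ⟩ = 0)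
    (χ₁ χ₂ : ↥((v.primeBelow ι 𝔐).decompositionSubgroup (absoluteGaloisGroup K)) → ZMod P)
    (hχ : ∀ σ : ↥((v.primeBelow ι 𝔐).decompositionSubgroup (absoluteGaloisGroup K)),
      (∑ x, conjCocycle (fixingGal k) (s x) (kummerPhiCocycle hζ hζk htriv ρ a₂ b₂)).1
        ⟨σ, hDN σ.2⟩ = ρ (χ₁ σ, χ₂ σ))
    (hIχ₁ : ∀ c : ZMod P, ∃ σ : ↥((v.primeBelow ι 𝔐).decompositionSubgroup (absoluteGaloisGroup K)),
      (σ : absoluteGaloisGroup K) ∈ (v.primeBelow ι 𝔐).inertia (absoluteGaloisGroup K) ∧ χ₁ σ = c)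
    (hIχ₂ : ∀ σ : ↥((v.primeBelow ι 𝔐).decompositionSubgroup (absoluteGaloisGroup K)),
      (σ : absoluteGaloisGroup K) ∈ (v.primeBelow ι 𝔐).inertia (absoluteGaloisGroup K) → χ₂ σ = 0)
    (hF : ∀ hφ : resGalOfEmb ι σL ∈ (v.primeBelow ι 𝔐).decompositionSubgroup (absoluteGaloisGroup K),
      IsUnit (χ₂ ⟨resGalOfEmb ι σL, hφ⟩))
    -- the level-`P*` junk root and (SC2′)
    (hjunk : ∃ c : WeierstrassCurve.geomPoints W,
      (∀ σ ∈ (v.primeBelow ι 𝔐).decompositionSubgroup (absoluteGaloisGroup K), σ • c = c) ∧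
        P • c = (P * (P - 1) / 2) • ((ρ (1, 0) : ↥(WeierstrassCurve.geomTorsion W (P : ℤ))) :
          WeierstrassCurve.geomPoints W))
    (hSC2 : ∀ x : WeierstrassCurve.geomPoints W, (∀ σ : absoluteGaloisGroup K, σ • x = x) →
      ∃ y : WeierstrassCurve.geomPoints W,
        (∀ σ ∈ (v.primeBelow ι 𝔐).decompositionSubgroup (absoluteGaloisGroup K), σ • y = y) ∧
          P • y = x) :
    index W
      (resH1Hom (ContinuousMonoidHom.id (absoluteGaloisGroup K))
          (WeierstrassCurve.geomTorsion W (P : ℤ)).subtype (geomTorsion_subtype_smul W P)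
          (coresH1 (fixingGal k) hN (kummerPhi hζ hζk htriv ρ a₁ b₁)) -
        resH1Hom (ContinuousMonoidHom.id (absoluteGaloisGroup K))
          (WeierstrassCurve.geomTorsion W (P : ℤ)).subtype (geomTorsion_subtype_smul W P)
          (coresH1 (fixingGal k) hN (kummerPhi hζ hζk htriv ρ a₂ b₂))) = P ^ 2 := by
  -- the prime `𝔓 = 𝔓_{ι,𝔐}` and the Frobenius `φ = σL|_{K̄}`
  have h𝔓 : v.primeBelow ι 𝔐 ∈ v.primesAbove := primeBelow_mem_primesAbove h𝔐
  haveI : (v.primeBelow ι 𝔐).IsPrime := h𝔓.1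
  have hφ : IsArithFrobAt (𝓞 K) (resGalOfEmb ι σL) (v.primeBelow ι 𝔐) :=
    WeierstrassCurve.isArithFrobAt_resGalOfEmb h𝔐 ι hσL
  have hφD : resGalOfEmb ι σL ∈ (v.primeBelow ι 𝔐).decompositionSubgroup (absoluteGaloisGroup K) :=
    hφ.mem_stabilizer
  have hvP : ((P : ℕ) : 𝓞 K) ∉ v.asIdeal := by
    have h := WeierstrassCurve.pow_natCast_not_mem hp n
    rw [Int.cast_natCast, ← hP] at h
    exact h
  -- the cocycles
  set θ₁ := kummerPhiCocycle hζ hζk htriv ρ a₁ b₁ with hθ₁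
  set θ₂ := kummerPhiCocycle hζ hζk htriv ρ a₂ b₂ with hθ₂
  set ξ : contOneCocycles (discreteTopRep (absoluteGaloisGroup K) (WeierstrassCurve.geomPoints W)) :=
    contOneCocycles.pullback (ContinuousMonoidHom.id (absoluteGaloisGroup K))
      (resHomOfEquivariant (ContinuousMonoidHom.id (absoluteGaloisGroup K))
        (WeierstrassCurve.geomTorsion W (P : ℤ)).subtype (geomTorsion_subtype_smul W P))
      (coresCocycle (fixingGal k) hN hs θ₁ - coresCocycle (fixingGal k) hN hs θ₂) with hξdef
  have hξapply : ∀ σ : absoluteGaloisGroup K, ξ.1 σ =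
      (((coresCocycle (fixingGal k) hN hs θ₁).1 σ - (coresCocycle (fixingGal k) hN hs θ₂).1 σ :
        ↥(WeierstrassCurve.geomTorsion W (P : ℤ))) : WeierstrassCurve.geomPoints W) := fun σ ↦ rfl
  -- its class is the difference of the two classes
  have hclass : oneCocycleClass _ ξ =
      resH1Hom (ContinuousMonoidHom.id (absoluteGaloisGroup K))
          (WeierstrassCurve.geomTorsion W (P : ℤ)).subtype (geomTorsion_subtype_smul W P)
          (coresH1 (fixingGal k) hN (kummerPhi hζ hζk htriv ρ a₁ b₁)) -
        resH1Hom (ContinuousMonoidHom.id (absoluteGaloisGroup K))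
          (WeierstrassCurve.geomTorsion W (P : ℤ)).subtype (geomTorsion_subtype_smul W P)
          (coresH1 (fixingGal k) hN (kummerPhi hζ hζk htriv ρ a₂ b₂)) := by
    rw [kummerPhi, kummerPhi, coresH1_oneCocycleClass (fixingGal k) hN hs,
      coresH1_oneCocycleClass (fixingGal k) hN hs, ← map_sub, ← oneCocycleClass_sub,
      resH1Hom_oneCocycleClass]
  rw [← hclass]
  -- values on `N`: the norm cocycles `Θ_n`
  have hcoresN : ∀ (θ : contOneCocycles (discreteTopRep (fixingGal k)
      ↥(WeierstrassCurve.geomTorsion W (P : ℤ)))) (σ : absoluteGaloisGroup K) (hσ : σ ∈ fixingGal k),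
      (coresCocycle (fixingGal k) hN hs θ).1 σ =
        (∑ x, conjCocycle (fixingGal k) (s x) θ).1 ⟨σ, hσ⟩ := by
    intro θ σ hσ
    rw [← resCocycle_coresCocycle (fixingGal k) hN hs θ, resCocycle_apply]
  -- the basis vectors
  set T₁ : WeierstrassCurve.geomPoints W := ((ρ (1, 0) : ↥(WeierstrassCurve.geomTorsion W (P : ℤ))) :
    WeierstrassCurve.geomPoints W) with hT₁
  set T₂ : WeierstrassCurve.geomPoints W := ((ρ (0, 1) : ↥(WeierstrassCurve.geomTorsion W (P : ℤ))) :
    WeierstrassCurve.geomPoints W) with hT₂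
  have hρcoord : ∀ x y : ZMod P,
      ((ρ (x, y) : ↥(WeierstrassCurve.geomTorsion W (P : ℤ))) : WeierstrassCurve.geomPoints W) =
        x.val • T₁ + y.val • T₂ := by
    intro x y
    have e : (x, y) = x.val • ((1 : ZMod P), (0 : ZMod P)) + y.val • ((0 : ZMod P), (1 : ZMod P)) := by
      ext <;> simp
    rw [e, map_add, map_nsmul, map_nsmul, AddSubgroup.coe_add, AddSubgroup.coe_nsmul,
      AddSubgroup.coe_nsmul]
  have hTors : ∀ m : ↥(WeierstrassCurve.geomTorsion W (P : ℤ)),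
      P • (m : WeierstrassCurve.geomPoints W) = 0 := fun m ↦ by
    rw [← AddSubgroup.coe_nsmul, nsmul_geomTorsion_eq_zero W P m, AddSubgroup.coe_zero]
  have hT₁P : P • T₁ = 0 := hTors _
  have hT₂P : P • T₂ = 0 := hTors _
  -- the norm cocycle `Θ₂` on `D_𝔓` and the coordinate characters
  set Θ₂ := ∑ x, conjCocycle (fixingGal k) (s x) θ₂ with hΘ₂
  have hΘadd : ∀ σ τ : fixingGal k, Θ₂.1 (σ * τ) = Θ₂.1 σ + Θ₂.1 τ := fun σ τ ↦ by
    rw [Θ₂.2 σ τ, discreteTopRep_ρ_apply, htriv]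
  have hχadd : ∀ σ τ : ↥((v.primeBelow ι 𝔐).decompositionSubgroup (absoluteGaloisGroup K)),
      (χ₁ (σ * τ), χ₂ (σ * τ)) = (χ₁ σ + χ₁ τ, χ₂ σ + χ₂ τ) := by
    intro σ τ
    apply hρ
    rw [← hχ, ← Prod.mk_add_mk, map_add, ← hχ, ← hχ, ← hΘadd]
    rfl
  have hχ₁add : ∀ σ τ, χ₁ (σ * τ) = χ₁ σ + χ₁ τ := fun σ τ ↦ congrArg Prod.fst (hχadd σ τ)
  have hχ₂add : ∀ σ τ, χ₂ (σ * τ) = χ₂ σ + χ₂ τ := fun σ τ ↦ congrArg Prod.snd (hχadd σ τ)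
  -- the open kernel of `Θ₂ ∘ incl`
  have hΘ1 : Θ₂.1 1 = 0 := by
    have h := hΘadd 1 1
    rw [mul_one] at h
    simpa using h
  obtain ⟨Kθ, hKθ⟩ : ∃ Kθ : Subgroup ↥((v.primeBelow ι 𝔐).decompositionSubgroup (absoluteGaloisGroup K)),
      ∀ σ, σ ∈ Kθ ↔ Θ₂.1 ⟨σ, hDN σ.2⟩ = 0 := by
    refine ⟨{ carrier := {σ | Θ₂.1 ⟨σ, hDN σ.2⟩ = 0}
              mul_mem' := fun {σ τ} hσ hτ ↦ ?_
              one_mem' := hΘ1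
              inv_mem' := fun {σ} hσ ↦ ?_ }, fun σ ↦ Iff.rfl⟩
    · simp only [Set.mem_setOf_eq] at hσ hτ ⊢
      have e : (⟨((σ * τ : ↥((v.primeBelow ι 𝔐).decompositionSubgroup (absoluteGaloisGroup K))) :
          absoluteGaloisGroup K), hDN (σ * τ).2⟩ : fixingGal k) = ⟨σ, hDN σ.2⟩ * ⟨τ, hDN τ.2⟩ := rfl
      rw [e, hΘadd, hσ, hτ, add_zero]
    · simp only [Set.mem_setOf_eq] at hσ ⊢
      have e : (⟨((σ⁻¹ : ↥((v.primeBelow ι 𝔐).decompositionSubgroup (absoluteGaloisGroup K))) :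
          absoluteGaloisGroup K), hDN σ⁻¹.2⟩ : fixingGal k) = ⟨σ, hDN σ.2⟩⁻¹ := rfl
      have h := hΘadd ⟨σ, hDN σ.2⟩⁻¹ ⟨σ, hDN σ.2⟩
      rw [inv_mul_cancel, hΘ1, hσ, add_zero] at h
      rw [e]
      exact h.symm
  have hKθopen : IsOpen (Kθ : Set ↥((v.primeBelow ι 𝔐).decompositionSubgroup (absoluteGaloisGroup K))) := by
    have hcont : Continuous fun σ : ↥((v.primeBelow ι 𝔐).decompositionSubgroup (absoluteGaloisGroup K)) ↦
        Θ₂.1 ⟨σ, hDN σ.2⟩ :=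
      Θ₂.1.continuous.comp (Continuous.subtype_mk continuous_subtype_val _)
    have e : (Kθ : Set ↥((v.primeBelow ι 𝔐).decompositionSubgroup (absoluteGaloisGroup K))) =
        (fun σ : ↥((v.primeBelow ι 𝔐).decompositionSubgroup (absoluteGaloisGroup K)) ↦
          Θ₂.1 ⟨σ, hDN σ.2⟩) ⁻¹' {0} := by
      ext σ
      exact hKθ σ
    rw [e]
    exact (isOpen_discrete _).preimage hcont
  have hKθle : ∀ σ ∈ Kθ, χ₁ σ = 0 ∧ χ₂ σ = 0 := by
    intro σ hσ
    rw [hKθ] at hσ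
    have h := hχ σ
    rw [hσ, eq_comm, ← map_zero ρ] at h
    have h2 := hρ h
    exact ⟨congrArg Prod.fst h2, congrArg Prod.snd h2⟩
  have hopen : ∀ (χ : ↥((v.primeBelow ι 𝔐).decompositionSubgroup (absoluteGaloisGroup K)) → ZMod P)
      (hχa : ∀ σ τ, χ (σ * τ) = χ σ + χ τ) (hle : ∀ σ ∈ Kθ, χ σ = 0),
      IsOpen {σ : ↥((v.primeBelow ι 𝔐).decompositionSubgroup (absoluteGaloisGroup K)) | -χ σ = 0} := by
    intro χ hχa hle
    obtain ⟨K', hK'⟩ := TwistedOrbit.exists_charKer χ hχa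
    have hle' : Kθ ≤ K' := fun σ hσ ↦ (hK' σ).mpr (hle σ hσ)
    have hK'open : IsOpen (K' : Set ↥((v.primeBelow ι 𝔐).decompositionSubgroup (absoluteGaloisGroup K))) :=
      Subgroup.isOpen_mono hle' hKθopen
    convert hK'open using 1
    ext σ
    rw [Set.mem_setOf_eq, neg_eq_zero, SetLike.mem_coe, hK']
  -- the decomposition data
  refine index_eq_sq_of_decompositionData W hv hvP h𝔓 hφ ξ (fun σ ↦ ?_) hT₁P hT₂P ?_ ?_ hjunk
    (fun σ ↦ -χ₁ σ) (fun σ ↦ -χ₂ σ) ?_ ?_ ?_ ?_ ?_ ?_ ?_ ?_ ?_ hSC2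
  · -- `P • ξ σ = 0`
    rw [hξapply]
    exact hTors _
  · -- independence of `T₁, T₂`
    intro m m' h
    have e1 : (m : ℤ) • T₁ = ((ρ ((m : ZMod P), 0) : ↥(WeierstrassCurve.geomTorsion W (P : ℤ))) :
        WeierstrassCurve.geomPoints W) := by
      rw [hT₁, ← AddSubgroup.coe_zsmul, ← map_zsmul, Prod.smul_mk, zsmul_one, smul_zero]
    have e2 : (m' : ℤ) • T₂ = ((ρ (0, (m' : ZMod P)) : ↥(WeierstrassCurve.geomTorsion W (P : ℤ))) :
        WeierstrassCurve.geomPoints W) := by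
      rw [hT₂, ← AddSubgroup.coe_zsmul, ← map_zsmul, Prod.smul_mk, zsmul_one, smul_zero]
    rw [e1, e2, ← AddSubgroup.coe_add, ← map_add, Prod.mk_add_mk, add_zero, zero_add,
      ZeroMemClass.coe_eq_zero, ← map_zero ρ] at h
    have h2 := hρ h
    rw [Prod.mk_eq_zero, ZMod.intCast_zmod_eq_zero_iff_dvd, ZMod.intCast_zmod_eq_zero_iff_dvd] at h2
    exact h2
  · -- `E[P]` is fixed by `D_𝔓 ≤ 𝔤_k`
    intro a ha σ hσ
    have ha' : a ∈ WeierstrassCurve.geomTorsion W (P : ℤ) := by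
      change (P : ℤ) • a = 0
      rw [natCast_zsmul, ha]
    exact congrArg Subtype.val (htriv ⟨σ, hDN hσ⟩ ⟨a, ha'⟩)
  · intro σ τ
    rw [hχ₁add, neg_add]
  · intro σ τ
    rw [hχ₂add, neg_add]
  · exact hopen χ₁ hχ₁add fun σ hσ ↦ (hKθle σ hσ).1
  · exact hopen χ₂ hχ₂add fun σ hσ ↦ (hKθle σ hσ).2
  · intro c
    obtain ⟨σ, hσ, hc⟩ := hIχ₁ (-c)
    exact ⟨σ, hσ, by rw [hc, neg_neg]⟩
  · intro σ hσ
    rw [hIχ₂ σ hσ, neg_zero]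
  · exact (hF hφD).neg
  · -- nice points from torsion
    intro f hf a ha
    have ha' : p ^ n • a = 0 := by rw [← hP]; exact ha
    exact exists_inertia_fixed_frobenius_pow_sub_eq W hp hv h𝔐 ι hσL hf a ha'
  · -- the local shape
    intro σ
    rw [hξapply, hcoresN θ₁ σ (hDN σ.2), hcoresN θ₂ σ (hDN σ.2), hfar σ σ.2, zero_sub,
      ← hΘ₂, hχ σ, ← map_neg, Prod.neg_mk, hρcoord]

end Literature.NumberTheory.EllipticCurves
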